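/-
Copyright: the b2b-balaban T⁴-continuum CRUX team, row NE7b OWNER lineage `t4-ne7b-p1` (gen 142). Project licence.
-/
import Summits.QuantumFields.BalabanUV.T4Continuum.Spine.NE7b.SupFourthKernelTwoPointLetters
import Summits.QuantumFields.BalabanUV.T4Continuum.Spine.NE7b.SupHessianVectorGeometryLetters
import Summits.QuantumFields.BalabanUV.T4Continuum.Spine.NE7b.SupFourPointTreeRowSum
import Summits.QuantumFields.BalabanUV.T4Continuum.Spine.NE7b.SupWhitenedFourthKernelPieces

/-!
# FINITE-SUM TOOLS FOR THE FOUR FIXED-SLOT LETTERS OF THE ORDER-FOUR ENTRY MAJORANT (the order-4 block of the kernel-letter CLASS MAP, third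
# file).  (526)'s background-free majorant `M_{xyzt}` of `|∂⁴W[e_y,e_z,e_t,e_x]|` is a sum of: `K4_{yztx}`; seven two-point letters
# `E(a,b) = Σ_w(Dᵀa)_w(Dᵀb)_w∕c` between the vectors `k^{abc}_w = Σ_u|A_{uw}|K4_{abcu}`, `b^v_w = Σ_u|A_{uw}|Hk_{vu}`, `g^{ab}_w = Σ_u|A_{uw}|K3_{abu}`;
# six supported three-point terms `𝟙[Hk ≠ 0]·C∕(ρρ)` (a STAR at `x` or a PATH through `x`); and the sixteen-tree polynomial of `κ₄`.  To
# ITERATE, the class map needs `Σ` of `M` over three indices with EACH of the four slots fixed.  This file supplies the generic pieces: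
# §1 three "master" two-point sums (a MASS family against a COLUMN family, in either order of the factors and of the summations; from (480)
# `two_point_family_sum_le`), §2 the `K4`-vector masses with the second or third slot fixed (letters `k4s2`, `k4s3`; (512) has slots one and
# four), §3 sums of supported terms (`Σ_i 𝟙[h_i ≠ 0]g_i ≤ n·B`) and the EIGHT star∕path tree sums with a support edge (root at each vertex),
# §4 the sixteen-tree sums with the second, third or fourth site fixed (from (488) by the symmetry of `r` — three reversed pairs rewritten),
# §5 `sum3_swap13` (the one reindexing (522) lacks) (row NE7b, node U5c; (480), (512), (510), (488), (522) BY NAME; [folklore] finite sums)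

Cell `pub-balaban`, sub-cell `t4`, spine estimate NE7b (`T4WeightBudget.RelWeightBound`; the cell's OWN estimate — NOT PRINTED in
[Bałaban 1983–89], NOT PROVED).  Crux-route work under `Spine/NE7b/` by the row OWNER (`t4-ne7b-p1` gen 142, file (527)) under FREEZE
(0)'s crux-prover clause; NOTHING of Bałaban's is named as a Lean object, valued or asserted; no `T4Continuum/Support` leaf typed; no
`def`, no notation; zero `sorry`.  Imports (BY NAME): the OWNER's (512) `…SupFourthKernelTwoPointLetters` ((480) `two_point_family_sum_le`,
`two_point_symm` through it), (510) `…SupHessianVectorGeometryLetters` ((463) `tree_double_sum_le`), (488) `…SupFourPointTreeRowSum`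
(`tree_sum_row_le`), (522) `…SupWhitenedFourthKernelPieces` (`sum3_*`).

WHAT IS PROVED ([folklore]): §1 `master_two_point`, `master_two_point_rev`, `master_two_point_single_rev`; §2 `third_vector_mass_two`,
`third_vector_mass_three`; §3 `sum_ite_zero`, `ite_support_sum_le`, `star_root_x`, `star_root_i`, `star_root_j`, `star_root_k`, `path_root_x`,
`path_root_a`, `path_root_b`, `path_root_c`; §4 `tree16_sum_slot_two`, `tree16_sum_slot_three`, `tree16_sum_slot_four`; §5 `sum3_swap13`; §6 toy.

HONEST (what this is NOT).  Finite sums; the four slot letters of `M` themselves (the instantiation) are the next files; scalar skeleton ((A3),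
NC-NE7b-α UNRULED); nothing of Bałaban's asserted.  BY-NAME EFFECT ON THE WALL: NONE.  NE7b NOT PRINTED ∕ NOT PROVED; spine PROVED 0∕9; rung
(B)+1 — the programme's measures remain FINITE-torus statements; NOT the mass gap, NOT Clay.  HONEST DEPENDENCY: continuum YM on T⁴ ⇐ BetaPertH ∧
nine spine estimates (0∕9 proved); BetaPertH ⇐ (D1) ∧ (D4) ∧ CAP+tail; G-an2-4 gates asym, D1 and NE2∕3∕4.
-/

set_option autoImplicit false
set_option maxSynthPendingDepth 3

noncomputable section

namespace Summit.QuantumFields.BalabanUV.T4Continuum.NE7b.SupFourthKernelSlotSums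

open Finset Real
open scoped BigOperators
open SupThirdKernelEntryLetters (two_point_symm two_point_family_sum_le)
open SupThirdCumulantTreeDecay (tree_double_sum_le)
open SupFourPointTreeRowSum (tree_sum_row_le)

variable {ι κ : Type} [Fintype ι] [DecidableEq ι] [Fintype κ] [DecidableEq κ]

/-! ## §1. The master two-point sums -/

section Master

variable {D : κ → κ → ℝ} {dr dc c : ℝ}

omit [DecidableEq ι] [Fintype ι] [DecidableEq κ] in
/-- **MASS × COLUMN**: `Σ_pΣ_v E(a_p, b_v) ≤ am·bc·dr·dc∕c` for a family `a` of total mass `Σ_pΣ_w a_{pw} ≤ am` and a family `b` with column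
letter `Σ_v b_{vw} ≤ bc` (all `w`). [folklore] -/
theorem master_two_point {β γ : Type} [Fintype β] [Fintype γ] [Nonempty κ] {a : β → κ → ℝ} {b : γ → κ → ℝ} {am bc : ℝ}
    (hD : ∀ x y, 0 ≤ D x y) (hDr : ∀ z, ∑ w, D z w ≤ dr) (hDc : ∀ w, ∑ z, D z w ≤ dc) (hc : 0 < c)
    (ha : ∀ p z, 0 ≤ a p z) (hb : ∀ v z, 0 ≤ b v z) (ham : ∑ p, ∑ z, a p z ≤ am) (hbc : ∀ z, ∑ v, b v z ≤ bc) (hbc0 : 0 ≤ bc) :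
    ∑ p, ∑ v, ∑ w, (∑ z', D z' w * (a p) z') * (∑ z', D z' w * (b v) z') / c ≤ am * bc * dr * dc / c := by
  obtain ⟨w₀⟩ := ‹Nonempty κ›
  have hdr : 0 ≤ dr := (Finset.sum_nonneg fun w _ => hD w₀ w).trans (hDr w₀)
  have hdc : 0 ≤ dc := (Finset.sum_nonneg fun z _ => hD z w₀).trans (hDc w₀)
  have hK : 0 ≤ bc * dr * dc / c := by positivity
  calc ∑ p, ∑ v, ∑ w, (∑ z', D z' w * (a p) z') * (∑ z', D z' w * (b v) z') / c ≤ ∑ p, (∑ z, a p z) * bc * dr * dc / c :=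
        Finset.sum_le_sum fun p _ => two_point_family_sum_le hD hDr hDc hc (ha p) hb hbc
    _ = (∑ p, ∑ z, a p z) * (bc * dr * dc / c) := by rw [Finset.sum_mul]; exact Finset.sum_congr rfl fun p _ => by ring
    _ ≤ am * (bc * dr * dc / c) := mul_le_mul_of_nonneg_right ham hK
    _ = am * bc * dr * dc / c := by ring

omit [DecidableEq ι] [Fintype ι] [DecidableEq κ] in
/-- **COLUMN × MASS, column index outer**: `Σ_vΣ_p E(b_v, a_p) ≤ am·bc·dr·dc∕c`. [folklore] -/
theorem master_two_point_rev {β γ : Type} [Fintype β] [Fintype γ] [Nonempty κ] {a : β → κ → ℝ} {b : γ → κ → ℝ} {am bc : ℝ}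
    (hD : ∀ x y, 0 ≤ D x y) (hDr : ∀ z, ∑ w, D z w ≤ dr) (hDc : ∀ w, ∑ z, D z w ≤ dc) (hc : 0 < c)
    (ha : ∀ p z, 0 ≤ a p z) (hb : ∀ v z, 0 ≤ b v z) (ham : ∑ p, ∑ z, a p z ≤ am) (hbc : ∀ z, ∑ v, b v z ≤ bc) (hbc0 : 0 ≤ bc) :
    ∑ v, ∑ p, ∑ w, (∑ z', D z' w * (b v) z') * (∑ z', D z' w * (a p) z') / c ≤ am * bc * dr * dc / c := by
  calc ∑ v, ∑ p, ∑ w, (∑ z', D z' w * (b v) z') * (∑ z', D z' w * (a p) z') / c = ∑ v, ∑ p, ∑ w, (∑ z', D z' w * (a p) z') * (∑ z', D z' w * (b v)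
      z') / c :=
        Finset.sum_congr rfl fun v _ => Finset.sum_congr rfl fun p _ => two_point_symm _ _ D c
    _ = ∑ p, ∑ v, ∑ w, (∑ z', D z' w * (a p) z') * (∑ z', D z' w * (b v) z') / c := Finset.sum_comm
    _ ≤ _ := master_two_point hD hDr hDc hc ha hb ham hbc hbc0

omit [DecidableEq ι] [Fintype ι] [DecidableEq κ] in
/-- **COLUMN × SINGLE VECTOR**: `Σ_v E(b_v, a) ≤ (Σa)·bc·dr·dc∕c`. [folklore] -/
theorem master_two_point_single_rev {γ : Type} [Fintype γ] {a : κ → ℝ} {b : γ → κ → ℝ} {bc : ℝ}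
    (hD : ∀ x y, 0 ≤ D x y) (hDr : ∀ z, ∑ w, D z w ≤ dr) (hDc : ∀ w, ∑ z, D z w ≤ dc) (hc : 0 < c)
    (ha : ∀ z, 0 ≤ a z) (hb : ∀ v z, 0 ≤ b v z) (hbc : ∀ z, ∑ v, b v z ≤ bc) :
    ∑ v, ∑ w, (∑ z', D z' w * (b v) z') * (∑ z', D z' w * a z') / c ≤ (∑ z, a z) * bc * dr * dc / c := by
  calc ∑ v, ∑ w, (∑ z', D z' w * (b v) z') * (∑ z', D z' w * a z') / c = ∑ v, ∑ w, (∑ z', D z' w * a z') * (∑ z', D z' w * (b v) z') / c :=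
      Finset.sum_congr rfl fun v _ => two_point_symm _ _ D c
    _ ≤ _ := two_point_family_sum_le hD hDr hDc hc ha hb hbc

end Master

/-! ## §2. The `K4`-vector masses with the second or the third slot fixed -/

section Masses

variable {K4 : ι → ι → ι → ι → ℝ} {A : Matrix ι κ ℝ} {αr k4s2 k4s3 : ℝ}

omit [DecidableEq ι] [DecidableEq κ] in
/-- **Slot-2 mass**: `Σ_xΣ_tΣ_w k^{xyt}_w ≤ αr·k4s2` for the letter `Σ_xΣ_tΣ_u K4_{xytu} ≤ k4s2`. [folklore] -/
theorem third_vector_mass_two (hK40 : ∀ x y z u, 0 ≤ K4 x y z u) (hαr : ∀ u, ∑ w, |A u w| ≤ αr)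
    (hk4s2 : ∀ y, ∑ x, ∑ t, ∑ u, K4 x y t u ≤ k4s2) (y : ι) : ∑ x, ∑ t, ∑ w, ∑ u, |A u w| * K4 x y t u ≤ αr * k4s2 := by
  rcases isEmpty_or_nonempty ι with hι | ⟨⟨u₀⟩⟩
  · exact (hι.false y).elim
  have hαr0 : 0 ≤ αr := (Finset.sum_nonneg fun w _ => abs_nonneg (A u₀ w)).trans (hαr u₀)
  have hin : ∀ x t, ∑ w, ∑ u, |A u w| * K4 x y t u ≤ αr * ∑ u, K4 x y t u := fun x t => by
    rw [Finset.sum_comm, Finset.mul_sum]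
    refine Finset.sum_le_sum fun u _ => ?_
    calc ∑ w, |A u w| * K4 x y t u = (∑ w, |A u w|) * K4 x y t u := (Finset.sum_mul _ _ _).symm
      _ ≤ αr * K4 x y t u := mul_le_mul_of_nonneg_right (hαr u) (hK40 x y t u)
  calc ∑ x, ∑ t, ∑ w, ∑ u, |A u w| * K4 x y t u ≤ ∑ x, ∑ t, αr * ∑ u, K4 x y t u :=
        Finset.sum_le_sum fun x _ => Finset.sum_le_sum fun t _ => hin x t
    _ = αr * ∑ x, ∑ t, ∑ u, K4 x y t u := by simp only [Finset.mul_sum]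
    _ ≤ αr * k4s2 := mul_le_mul_of_nonneg_left (hk4s2 y) hαr0

omit [DecidableEq ι] [DecidableEq κ] in
/-- **Slot-3 mass**: `Σ_xΣ_yΣ_w k^{xyz}_w ≤ αr·k4s3` for the letter `Σ_xΣ_yΣ_u K4_{xyzu} ≤ k4s3`. [folklore] -/
theorem third_vector_mass_three (hK40 : ∀ x y z u, 0 ≤ K4 x y z u) (hαr : ∀ u, ∑ w, |A u w| ≤ αr)
    (hk4s3 : ∀ z, ∑ x, ∑ y, ∑ u, K4 x y z u ≤ k4s3) (z : ι) : ∑ x, ∑ y, ∑ w, ∑ u, |A u w| * K4 x y z u ≤ αr * k4s3 := by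
  rcases isEmpty_or_nonempty ι with hι | ⟨⟨u₀⟩⟩
  · exact (hι.false z).elim
  have hαr0 : 0 ≤ αr := (Finset.sum_nonneg fun w _ => abs_nonneg (A u₀ w)).trans (hαr u₀)
  have hin : ∀ x y, ∑ w, ∑ u, |A u w| * K4 x y z u ≤ αr * ∑ u, K4 x y z u := fun x y => by
    rw [Finset.sum_comm, Finset.mul_sum]
    refine Finset.sum_le_sum fun u _ => ?_
    calc ∑ w, |A u w| * K4 x y z u = (∑ w, |A u w|) * K4 x y z u := (Finset.sum_mul _ _ _).symm
      _ ≤ αr * K4 x y z u := mul_le_mul_of_nonneg_right (hαr u) (hK40 x y z u)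
  calc ∑ x, ∑ y, ∑ w, ∑ u, |A u w| * K4 x y z u ≤ ∑ x, ∑ y, αr * ∑ u, K4 x y z u :=
        Finset.sum_le_sum fun x _ => Finset.sum_le_sum fun y _ => hin x y
    _ = αr * ∑ x, ∑ y, ∑ u, K4 x y z u := by simp only [Finset.mul_sum]
    _ ≤ αr * k4s3 := mul_le_mul_of_nonneg_left (hk4s3 z) hαr0

end Masses

/-! ## §3. Supported sums: stars and paths with one support edge -/

section Support

variable {Hk : ι → ι → ℝ} {ρ : ι → ι → ℝ} {C S : ℝ} {n : ℕ}

omit [DecidableEq ι] [Fintype κ] [DecidableEq κ] in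
/-- A sum moves inside a vanishing branch: `Σ_i (if P then 0 else f_i) = if P then 0 else Σ_i f_i`. [folklore] -/
theorem sum_ite_zero {β : Type} [Fintype β] (P : Prop) [Decidable P] (f : β → ℝ) :
    ∑ i, (if P then (0 : ℝ) else f i) = if P then (0 : ℝ) else ∑ i, f i := by
  split_ifs <;> simp

omit [DecidableEq ι] [Fintype κ] [DecidableEq κ] in
/-- **A supported sum**: `0 ≤ g ≤ B` and at most `n` indices with `h_i ≠ 0` give `Σ_i (if h_i = 0 then 0 else g_i) ≤ n·B`. [folklore] -/
theorem ite_support_sum_le (h g : ι → ℝ) {B : ℝ} (hgB : ∀ i, g i ≤ B) (hB : 0 ≤ B)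
    (hn : (Finset.univ.filter (fun i => h i ≠ 0)).card ≤ n) : ∑ i, (if h i = 0 then (0 : ℝ) else g i) ≤ n * B := by
  have e : ∑ i, (if h i = 0 then (0 : ℝ) else g i) = ∑ i ∈ Finset.univ.filter (fun i => h i ≠ 0), g i := by
    rw [Finset.sum_filter]
    refine Finset.sum_congr rfl fun i _ => ?_
    by_cases hi : h i = 0
    · rw [if_pos hi, if_neg (not_not.2 hi)]
    · rw [if_neg hi, if_pos hi]
  rw [e]
  calc ∑ i ∈ Finset.univ.filter (fun i => h i ≠ 0), g i ≤ ∑ i ∈ Finset.univ.filter (fun i => h i ≠ 0), B := Finset.sum_le_sum fun i _ => hgB i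
    _ = (Finset.univ.filter (fun i => h i ≠ 0)).card * B := by rw [Finset.sum_const, nsmul_eq_mul]
    _ ≤ n * B := mul_le_mul_of_nonneg_right (Nat.cast_le.2 hn) hB

omit [DecidableEq ι] [Fintype κ] [DecidableEq κ] in
/-- One leaf at `x`: `Σ_k C∕(ρ_{xj}ρ_{xk}) ≤ C·S∕ρ_{xj} ≤ C·S` pieces — here `Σ_k C∕(ρ_{xj}ρ_{xk}) = C∕ρ_{xj}·Σ_k ρ_{xk}⁻¹`. [folklore] -/
theorem leaf_sum_eq (hρ1 : ∀ x y, 1 ≤ ρ x y) (x j : ι) : ∑ k, C / (ρ x j * ρ x k) = C / ρ x j * ∑ k, 1 / ρ x k := by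
  rw [Finset.mul_sum]
  refine Finset.sum_congr rfl fun k _ => ?_
  have h1 : ρ x j ≠ 0 := (lt_of_lt_of_le one_pos (hρ1 x j)).ne'
  have h2 : ρ x k ≠ 0 := (lt_of_lt_of_le one_pos (hρ1 x k)).ne'
  field_simp

omit [DecidableEq ι] [Fintype κ] [DecidableEq κ] in
/-- **STAR, root `x`** (support leaf outermost): `Σ_iΣ_jΣ_k 𝟙[Hk_{ix} ≠ 0]C∕(ρ_{xj}ρ_{xk}) ≤ n·(C·S²)`. [folklore] -/
theorem star_root_x (hC : 0 ≤ C) (hρ1 : ∀ x y, 1 ≤ ρ x y) (hS : ∀ x, ∑ y, 1 / ρ x y ≤ S)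
    (hn : ∀ x, (Finset.univ.filter (fun i => Hk i x ≠ 0)).card ≤ n) (x : ι) :
    ∑ i, ∑ j, ∑ k, (if Hk i x = 0 then (0 : ℝ) else C / (ρ x j * ρ x k)) ≤ n * (C * S ^ 2) := by
  have hS0 : 0 ≤ S := (Finset.sum_nonneg fun y _ => div_nonneg zero_le_one (zero_le_one.trans (hρ1 x y))).trans (hS x)
  simp_rw [sum_ite_zero]
  exact ite_support_sum_le (fun i => Hk i x) _ (fun i => tree_double_sum_le hC hρ1 x (hS x)) (by positivity) (hn x)

omit [DecidableEq ι] [Fintype κ] [DecidableEq κ] in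
/-- **STAR, root the support leaf `i`** (`x` summed, outermost): `Σ_xΣ_jΣ_k 𝟙[Hk_{ix} ≠ 0]C∕(ρ_{xj}ρ_{xk}) ≤ n·(C·S²)` (row support of `Hk`
at `i`). [folklore] -/
theorem star_root_i (hC : 0 ≤ C) (hρ1 : ∀ x y, 1 ≤ ρ x y) (hS : ∀ x, ∑ y, 1 / ρ x y ≤ S)
    (hn' : ∀ i, (Finset.univ.filter (fun x => Hk i x ≠ 0)).card ≤ n) (i : ι) :
    ∑ x, ∑ j, ∑ k, (if Hk i x = 0 then (0 : ℝ) else C / (ρ x j * ρ x k)) ≤ n * (C * S ^ 2) := by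
  have hS0 : 0 ≤ S := (Finset.sum_nonneg fun y _ => div_nonneg zero_le_one (zero_le_one.trans (hρ1 i y))).trans (hS i)
  simp_rw [sum_ite_zero]
  exact ite_support_sum_le (fun x => Hk i x) _ (fun x => tree_double_sum_le hC hρ1 x (hS x)) (by positivity) (hn' i)

omit [DecidableEq ι] [Fintype κ] [DecidableEq κ] in
/-- **STAR, root the first leaf `j`**: `Σ_xΣ_iΣ_k 𝟙[Hk_{ix} ≠ 0]C∕(ρ_{xj}ρ_{xk}) ≤ n·(C·S²)` (`ρ` symmetric). [folklore] -/
theorem star_root_j (hC : 0 ≤ C) (hρ1 : ∀ x y, 1 ≤ ρ x y) (hρsymm : ∀ x y, ρ x y = ρ y x) (hS : ∀ x, ∑ y, 1 / ρ x y ≤ S)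
    (hn : ∀ x, (Finset.univ.filter (fun i => Hk i x ≠ 0)).card ≤ n) (j : ι) :
    ∑ x, ∑ i, ∑ k, (if Hk i x = 0 then (0 : ℝ) else C / (ρ x j * ρ x k)) ≤ n * (C * S ^ 2) := by
  have hρ0 : ∀ x y, 0 < ρ x y := fun x y => lt_of_lt_of_le one_pos (hρ1 x y)
  have hS0 : 0 ≤ S := (Finset.sum_nonneg fun y _ => div_nonneg zero_le_one (hρ0 j y).le).trans (hS j)
  have hin : ∀ x, ∑ i, ∑ k, (if Hk i x = 0 then (0 : ℝ) else C / (ρ x j * ρ x k)) ≤ n * (C * S * (1 / ρ x j)) := fun x => by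
    simp_rw [sum_ite_zero]
    refine ite_support_sum_le (fun i => Hk i x) _ (fun i => ?_) (by have := (hρ0 x j).le; positivity) (hn x)
    rw [leaf_sum_eq hρ1 x j]
    calc C / ρ x j * ∑ k, 1 / ρ x k ≤ C / ρ x j * S := mul_le_mul_of_nonneg_left (hS x) (div_nonneg hC (hρ0 x j).le)
      _ = C * S * (1 / ρ x j) := by ring
  calc _ ≤ ∑ x, n * (C * S * (1 / ρ x j)) := Finset.sum_le_sum fun x _ => hin x
    _ = n * (C * S) * ∑ x, 1 / ρ j x := by rw [Finset.mul_sum]; exact Finset.sum_congr rfl fun x _ => by rw [hρsymm x j]; ring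
    _ ≤ n * (C * S) * S := mul_le_mul_of_nonneg_left (hS j) (by positivity)
    _ = n * (C * S ^ 2) := by ring

omit [DecidableEq ι] [Fintype κ] [DecidableEq κ] in
/-- **STAR, root the second leaf `k`**: `Σ_xΣ_iΣ_j 𝟙[Hk_{ix} ≠ 0]C∕(ρ_{xj}ρ_{xk}) ≤ n·(C·S²)` (`ρ` symmetric). [folklore] -/
theorem star_root_k (hC : 0 ≤ C) (hρ1 : ∀ x y, 1 ≤ ρ x y) (hρsymm : ∀ x y, ρ x y = ρ y x) (hS : ∀ x, ∑ y, 1 / ρ x y ≤ S)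
    (hn : ∀ x, (Finset.univ.filter (fun i => Hk i x ≠ 0)).card ≤ n) (k : ι) :
    ∑ x, ∑ i, ∑ j, (if Hk i x = 0 then (0 : ℝ) else C / (ρ x j * ρ x k)) ≤ n * (C * S ^ 2) := by
  have e : ∀ x i, ∑ j, (if Hk i x = 0 then (0 : ℝ) else C / (ρ x j * ρ x k)) = ∑ j, (if Hk i x = 0 then (0 : ℝ) else C / (ρ x k * ρ x j)) :=
    fun x i => Finset.sum_congr rfl fun j _ => by rw [mul_comm]
  simp_rw [e]
  exact star_root_j hC hρ1 hρsymm hS hn k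

omit [DecidableEq ι] [Fintype κ] [DecidableEq κ] in
/-- **PATH `a–b–x–c`, root `x`**: `Σ_bΣ_aΣ_c 𝟙[Hk_{ab} ≠ 0]C∕(ρ_{xb}ρ_{xc}) ≤ n·(C·S²)` (column support at every `b`). [folklore] -/
theorem path_root_x (hC : 0 ≤ C) (hρ1 : ∀ x y, 1 ≤ ρ x y) (hS : ∀ x, ∑ y, 1 / ρ x y ≤ S)
    (hn : ∀ b, (Finset.univ.filter (fun a => Hk a b ≠ 0)).card ≤ n) (x : ι) :
    ∑ b, ∑ a, ∑ c, (if Hk a b = 0 then (0 : ℝ) else C / (ρ x b * ρ x c)) ≤ n * (C * S ^ 2) := by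
  have hρ0 : ∀ x y, 0 < ρ x y := fun x y => lt_of_lt_of_le one_pos (hρ1 x y)
  have hS0 : 0 ≤ S := (Finset.sum_nonneg fun y _ => div_nonneg zero_le_one (hρ0 x y).le).trans (hS x)
  have hin : ∀ b, ∑ a, ∑ c, (if Hk a b = 0 then (0 : ℝ) else C / (ρ x b * ρ x c)) ≤ n * (C * S * (1 / ρ x b)) := fun b => by
    simp_rw [sum_ite_zero]
    refine ite_support_sum_le (fun a => Hk a b) _ (fun a => ?_) (by have := (hρ0 x b).le; positivity) (hn b)
    rw [leaf_sum_eq hρ1 x b]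
    calc C / ρ x b * ∑ c, 1 / ρ x c ≤ C / ρ x b * S := mul_le_mul_of_nonneg_left (hS x) (div_nonneg hC (hρ0 x b).le)
      _ = C * S * (1 / ρ x b) := by ring
  calc _ ≤ ∑ b, n * (C * S * (1 / ρ x b)) := Finset.sum_le_sum fun b _ => hin b
    _ = n * (C * S) * ∑ b, 1 / ρ x b := by rw [Finset.mul_sum]; exact Finset.sum_congr rfl fun b _ => by ring
    _ ≤ n * (C * S) * S := mul_le_mul_of_nonneg_left (hS x) (by positivity)
    _ = n * (C * S ^ 2) := by ring

omit [DecidableEq ι] [Fintype κ] [DecidableEq κ] in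
/-- **PATH, root the support end `a`**: `Σ_bΣ_xΣ_c 𝟙[Hk_{ab} ≠ 0]C∕(ρ_{xb}ρ_{xc}) ≤ n·(C·S²)` (row support at `a`; `ρ` symmetric). [folklore] -/
theorem path_root_a (hC : 0 ≤ C) (hρ1 : ∀ x y, 1 ≤ ρ x y) (hρsymm : ∀ x y, ρ x y = ρ y x) (hS : ∀ x, ∑ y, 1 / ρ x y ≤ S)
    (hn' : ∀ a, (Finset.univ.filter (fun b => Hk a b ≠ 0)).card ≤ n) (a : ι) :
    ∑ b, ∑ x, ∑ c, (if Hk a b = 0 then (0 : ℝ) else C / (ρ x b * ρ x c)) ≤ n * (C * S ^ 2) := by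
  have hρ0 : ∀ x y, 0 < ρ x y := fun x y => lt_of_lt_of_le one_pos (hρ1 x y)
  have hS0 : 0 ≤ S := (Finset.sum_nonneg fun y _ => div_nonneg zero_le_one (hρ0 a y).le).trans (hS a)
  have hleaf : ∀ b x, ∑ c, C / (ρ x b * ρ x c) ≤ C * S * (1 / ρ b x) := fun b x => by
    rw [leaf_sum_eq hρ1 x b, hρsymm x b]
    calc C / ρ b x * ∑ c, 1 / ρ x c ≤ C / ρ b x * S := mul_le_mul_of_nonneg_left (hS x) (div_nonneg hC (hρ0 b x).le)
      _ = C * S * (1 / ρ b x) := by ring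
  have hin : ∀ b, ∑ x, ∑ c, C / (ρ x b * ρ x c) ≤ C * S ^ 2 := fun b =>
    calc ∑ x, ∑ c, C / (ρ x b * ρ x c) ≤ ∑ x, C * S * (1 / ρ b x) := Finset.sum_le_sum fun x _ => hleaf b x
      _ = C * S * ∑ x, 1 / ρ b x := (Finset.mul_sum _ _ _).symm
      _ ≤ C * S * S := mul_le_mul_of_nonneg_left (hS b) (by positivity)
      _ = C * S ^ 2 := by ring
  simp_rw [sum_ite_zero]
  exact ite_support_sum_le (fun b => Hk a b) _ hin (by positivity) (hn' a)

omit [DecidableEq ι] [Fintype κ] [DecidableEq κ] in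
/-- **PATH, root the middle vertex `b`**: `Σ_aΣ_xΣ_c 𝟙[Hk_{ab} ≠ 0]C∕(ρ_{xb}ρ_{xc}) ≤ n·(C·S²)` (column support at `b`; `ρ` symmetric).
[folklore] -/
theorem path_root_b (hC : 0 ≤ C) (hρ1 : ∀ x y, 1 ≤ ρ x y) (hρsymm : ∀ x y, ρ x y = ρ y x) (hS : ∀ x, ∑ y, 1 / ρ x y ≤ S)
    (hn : ∀ b, (Finset.univ.filter (fun a => Hk a b ≠ 0)).card ≤ n) (b : ι) :
    ∑ a, ∑ x, ∑ c, (if Hk a b = 0 then (0 : ℝ) else C / (ρ x b * ρ x c)) ≤ n * (C * S ^ 2) := by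
  have hρ0 : ∀ x y, 0 < ρ x y := fun x y => lt_of_lt_of_le one_pos (hρ1 x y)
  have hS0 : 0 ≤ S := (Finset.sum_nonneg fun y _ => div_nonneg zero_le_one (hρ0 b y).le).trans (hS b)
  have hin : ∑ x, ∑ c, C / (ρ x b * ρ x c) ≤ C * S ^ 2 :=
    calc ∑ x, ∑ c, C / (ρ x b * ρ x c) ≤ ∑ x, C * S * (1 / ρ b x) := Finset.sum_le_sum fun x _ => by
            rw [leaf_sum_eq hρ1 x b, hρsymm x b]
            calc C / ρ b x * ∑ c, 1 / ρ x c ≤ C / ρ b x * S := mul_le_mul_of_nonneg_left (hS x) (div_nonneg hC (hρ0 b x).le)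
              _ = C * S * (1 / ρ b x) := by ring
      _ = C * S * ∑ x, 1 / ρ b x := (Finset.mul_sum _ _ _).symm
      _ ≤ C * S * S := mul_le_mul_of_nonneg_left (hS b) (by positivity)
      _ = C * S ^ 2 := by ring
  simp_rw [sum_ite_zero]
  exact ite_support_sum_le (fun a => Hk a b) _ (fun _ => hin) (by positivity) (hn b)

omit [DecidableEq ι] [Fintype κ] [DecidableEq κ] in
/-- **PATH, root the far end `c`**: `Σ_xΣ_bΣ_a 𝟙[Hk_{ab} ≠ 0]C∕(ρ_{xb}ρ_{xc}) ≤ n·(C·S²)` (column support at every `b`; `ρ` symmetric). [folklore] -/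
theorem path_root_c (hC : 0 ≤ C) (hρ1 : ∀ x y, 1 ≤ ρ x y) (hρsymm : ∀ x y, ρ x y = ρ y x) (hS : ∀ x, ∑ y, 1 / ρ x y ≤ S)
    (hn : ∀ b, (Finset.univ.filter (fun a => Hk a b ≠ 0)).card ≤ n) (c : ι) :
    ∑ x, ∑ b, ∑ a, (if Hk a b = 0 then (0 : ℝ) else C / (ρ x b * ρ x c)) ≤ n * (C * S ^ 2) := by
  have hρ0 : ∀ x y, 0 < ρ x y := fun x y => lt_of_lt_of_le one_pos (hρ1 x y)
  have hS0 : 0 ≤ S := (Finset.sum_nonneg fun y _ => div_nonneg zero_le_one (hρ0 c y).le).trans (hS c)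
  have hin : ∀ x b, ∑ a, (if Hk a b = 0 then (0 : ℝ) else C / (ρ x b * ρ x c)) ≤ n * (C / (ρ x b * ρ x c)) := fun x b =>
    ite_support_sum_le (fun a => Hk a b) _ (fun _ => le_rfl) (by have := (hρ0 x b).le; have := (hρ0 x c).le; positivity) (hn b)
  have hx : ∀ x, ∑ b, ∑ a, (if Hk a b = 0 then (0 : ℝ) else C / (ρ x b * ρ x c)) ≤ n * (C * S * (1 / ρ c x)) := fun x =>
    calc _ ≤ ∑ b, n * (C / (ρ x b * ρ x c)) := Finset.sum_le_sum fun b _ => hin x b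
      _ = n * ∑ b, C / (ρ x c * ρ x b) := by rw [Finset.mul_sum]; exact Finset.sum_congr rfl fun b _ => by rw [mul_comm (ρ x b)]
      _ = n * (C / ρ x c * ∑ b, 1 / ρ x b) := by rw [leaf_sum_eq hρ1 x c]
      _ ≤ n * (C / ρ x c * S) := mul_le_mul_of_nonneg_left (mul_le_mul_of_nonneg_left (hS x) (div_nonneg hC (hρ0 x c).le)) (Nat.cast_nonneg n)
      _ = n * (C * S * (1 / ρ c x)) := by rw [hρsymm x c]; ring
  calc _ ≤ ∑ x, n * (C * S * (1 / ρ c x)) := Finset.sum_le_sum fun x _ => hx x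
    _ = n * (C * S) * ∑ x, 1 / ρ c x := by rw [Finset.mul_sum]; exact Finset.sum_congr rfl fun x _ => by ring
    _ ≤ n * (C * S) * S := mul_le_mul_of_nonneg_left (hS c) (by positivity)
    _ = n * (C * S ^ 2) := by ring

end Support

/-! ## §4. The sixteen-tree sums with the second, third or fourth site fixed -/

section Tree

variable {r : ι → ι → ℝ} {S' : ℝ}

omit [DecidableEq ι] [Fintype κ] [DecidableEq κ] in
/-- **Slot 2 fixed**: `Σ_xΣ_zΣ_t TREE(x,y,z,t) ≤ 16·S′³` (`r` symmetric; (488) at root `y`, the pair `(y,x)` reversed). [folklore] -/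
theorem tree16_sum_slot_two (hrsymm : ∀ x y, r x y = r y x) (hSr : ∀ u, ∑ v, (r u v ^ 2)⁻¹ ≤ S') (y : ι) :
    ∑ x, ∑ z, ∑ t, ((r x y ^ 2)⁻¹ * (r x z ^ 2)⁻¹ * (r x t ^ 2)⁻¹ + (r x y ^ 2)⁻¹ * (r y z ^ 2)⁻¹ * (r y t ^ 2)⁻¹ + (r x z ^ 2)⁻¹ * (r y z ^ 2)⁻¹ *
        (r z t ^ 2)⁻¹ + (r x t ^ 2)⁻¹ * (r y t ^ 2)⁻¹ * (r z t ^ 2)⁻¹ + (r x y ^ 2)⁻¹ * (r y z ^ 2)⁻¹ * (r z t ^ 2)⁻¹ + (r x y ^ 2)⁻¹ * (r y t ^ 2)⁻¹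
        * (r z t ^ 2)⁻¹ + (r x z ^ 2)⁻¹ * (r y z ^ 2)⁻¹ * (r y t ^ 2)⁻¹ + (r x z ^ 2)⁻¹ * (r y t ^ 2)⁻¹ * (r z t ^ 2)⁻¹ + (r x t ^ 2)⁻¹ * (r y z ^
        2)⁻¹ * (r y t ^ 2)⁻¹ + (r x t ^ 2)⁻¹ * (r y z ^ 2)⁻¹ * (r z t ^ 2)⁻¹ + (r x y ^ 2)⁻¹ * (r x z ^ 2)⁻¹ * (r z t ^ 2)⁻¹ + (r x y ^ 2)⁻¹ * (r x t
        ^ 2)⁻¹ * (r z t ^ 2)⁻¹ + (r x y ^ 2)⁻¹ * (r x z ^ 2)⁻¹ * (r y t ^ 2)⁻¹ + (r x z ^ 2)⁻¹ * (r x t ^ 2)⁻¹ * (r y t ^ 2)⁻¹ + (r x y ^ 2)⁻¹ * (r x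
        t ^ 2)⁻¹ * (r y z ^ 2)⁻¹ + (r x z ^ 2)⁻¹ * (r x t ^ 2)⁻¹ * (r y z ^ 2)⁻¹) ≤ 16 * S' ^ 3 := by
  have hSc : ∀ v, ∑ u, (r u v ^ 2)⁻¹ ≤ S' := fun v => by simp_rw [hrsymm _ v]; exact hSr v
  have h := tree_sum_row_le (q := fun u v => (r u v ^ 2)⁻¹) (fun u v => by positivity) hSr hSc y
  refine le_trans (le_of_eq (Finset.sum_congr rfl fun x _ => Finset.sum_congr rfl fun z _ => Finset.sum_congr rfl fun t _ => ?_)) h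
  rw [hrsymm y x]; ring

omit [DecidableEq ι] [Fintype κ] [DecidableEq κ] in
/-- **Slot 3 fixed**: `Σ_xΣ_yΣ_t TREE(x,y,z,t) ≤ 16·S′³`. [folklore] -/
theorem tree16_sum_slot_three (hrsymm : ∀ x y, r x y = r y x) (hSr : ∀ u, ∑ v, (r u v ^ 2)⁻¹ ≤ S') (z : ι) :
    ∑ x, ∑ y, ∑ t, ((r x y ^ 2)⁻¹ * (r x z ^ 2)⁻¹ * (r x t ^ 2)⁻¹ + (r x y ^ 2)⁻¹ * (r y z ^ 2)⁻¹ * (r y t ^ 2)⁻¹ + (r x z ^ 2)⁻¹ * (r y z ^ 2)⁻¹ *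
        (r z t ^ 2)⁻¹ + (r x t ^ 2)⁻¹ * (r y t ^ 2)⁻¹ * (r z t ^ 2)⁻¹ + (r x y ^ 2)⁻¹ * (r y z ^ 2)⁻¹ * (r z t ^ 2)⁻¹ + (r x y ^ 2)⁻¹ * (r y t ^ 2)⁻¹
        * (r z t ^ 2)⁻¹ + (r x z ^ 2)⁻¹ * (r y z ^ 2)⁻¹ * (r y t ^ 2)⁻¹ + (r x z ^ 2)⁻¹ * (r y t ^ 2)⁻¹ * (r z t ^ 2)⁻¹ + (r x t ^ 2)⁻¹ * (r y z ^
        2)⁻¹ * (r y t ^ 2)⁻¹ + (r x t ^ 2)⁻¹ * (r y z ^ 2)⁻¹ * (r z t ^ 2)⁻¹ + (r x y ^ 2)⁻¹ * (r x z ^ 2)⁻¹ * (r z t ^ 2)⁻¹ + (r x y ^ 2)⁻¹ * (r x t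
        ^ 2)⁻¹ * (r z t ^ 2)⁻¹ + (r x y ^ 2)⁻¹ * (r x z ^ 2)⁻¹ * (r y t ^ 2)⁻¹ + (r x z ^ 2)⁻¹ * (r x t ^ 2)⁻¹ * (r y t ^ 2)⁻¹ + (r x y ^ 2)⁻¹ * (r x
        t ^ 2)⁻¹ * (r y z ^ 2)⁻¹ + (r x z ^ 2)⁻¹ * (r x t ^ 2)⁻¹ * (r y z ^ 2)⁻¹) ≤ 16 * S' ^ 3 := by
  have hSc : ∀ v, ∑ u, (r u v ^ 2)⁻¹ ≤ S' := fun v => by simp_rw [hrsymm _ v]; exact hSr v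
  have h := tree_sum_row_le (q := fun u v => (r u v ^ 2)⁻¹) (fun u v => by positivity) hSr hSc z
  refine le_trans (le_of_eq (Finset.sum_congr rfl fun x _ => Finset.sum_congr rfl fun y _ => Finset.sum_congr rfl fun t _ => ?_)) h
  rw [hrsymm z x, hrsymm z y]; ring

omit [DecidableEq ι] [Fintype κ] [DecidableEq κ] in
/-- **Slot 4 fixed**: `Σ_xΣ_yΣ_z TREE(x,y,z,t) ≤ 16·S′³`. [folklore] -/
theorem tree16_sum_slot_four (hrsymm : ∀ x y, r x y = r y x) (hSr : ∀ u, ∑ v, (r u v ^ 2)⁻¹ ≤ S') (t : ι) :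
    ∑ x, ∑ y, ∑ z, ((r x y ^ 2)⁻¹ * (r x z ^ 2)⁻¹ * (r x t ^ 2)⁻¹ + (r x y ^ 2)⁻¹ * (r y z ^ 2)⁻¹ * (r y t ^ 2)⁻¹ + (r x z ^ 2)⁻¹ * (r y z ^ 2)⁻¹ *
        (r z t ^ 2)⁻¹ + (r x t ^ 2)⁻¹ * (r y t ^ 2)⁻¹ * (r z t ^ 2)⁻¹ + (r x y ^ 2)⁻¹ * (r y z ^ 2)⁻¹ * (r z t ^ 2)⁻¹ + (r x y ^ 2)⁻¹ * (r y t ^ 2)⁻¹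
        * (r z t ^ 2)⁻¹ + (r x z ^ 2)⁻¹ * (r y z ^ 2)⁻¹ * (r y t ^ 2)⁻¹ + (r x z ^ 2)⁻¹ * (r y t ^ 2)⁻¹ * (r z t ^ 2)⁻¹ + (r x t ^ 2)⁻¹ * (r y z ^
        2)⁻¹ * (r y t ^ 2)⁻¹ + (r x t ^ 2)⁻¹ * (r y z ^ 2)⁻¹ * (r z t ^ 2)⁻¹ + (r x y ^ 2)⁻¹ * (r x z ^ 2)⁻¹ * (r z t ^ 2)⁻¹ + (r x y ^ 2)⁻¹ * (r x t
        ^ 2)⁻¹ * (r z t ^ 2)⁻¹ + (r x y ^ 2)⁻¹ * (r x z ^ 2)⁻¹ * (r y t ^ 2)⁻¹ + (r x z ^ 2)⁻¹ * (r x t ^ 2)⁻¹ * (r y t ^ 2)⁻¹ + (r x y ^ 2)⁻¹ * (r x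
        t ^ 2)⁻¹ * (r y z ^ 2)⁻¹ + (r x z ^ 2)⁻¹ * (r x t ^ 2)⁻¹ * (r y z ^ 2)⁻¹) ≤ 16 * S' ^ 3 := by
  have hSc : ∀ v, ∑ u, (r u v ^ 2)⁻¹ ≤ S' := fun v => by simp_rw [hrsymm _ v]; exact hSr v
  have h := tree_sum_row_le (q := fun u v => (r u v ^ 2)⁻¹) (fun u v => by positivity) hSr hSc t
  refine le_trans (le_of_eq (Finset.sum_congr rfl fun x _ => Finset.sum_congr rfl fun y _ => Finset.sum_congr rfl fun z _ => ?_)) h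
  rw [hrsymm t x, hrsymm t y, hrsymm t z]; ring

end Tree

/-! ## §5. One more reindexing -/

omit [DecidableEq ι] [Fintype κ] [DecidableEq κ] in
/-- `Σ_yΣ_zΣ_t f(t,z,y) = Σ_yΣ_zΣ_t f(y,z,t)` (swap of the outer and inner variables). [folklore] -/
theorem sum3_swap13 (f : ι → ι → ι → ℝ) : ∑ y, ∑ z, ∑ t, f t z y = ∑ y, ∑ z, ∑ t, f y z t := by
  have h1 : ∑ y, ∑ z, ∑ t, f t z y = ∑ y, ∑ t, ∑ z, f t z y := Finset.sum_congr rfl fun _ _ => Finset.sum_comm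
  rw [h1, Finset.sum_comm]
  exact Finset.sum_congr rfl fun _ _ => Finset.sum_comm

/-! ## §6. Toy -/

/-- Toy (§3's supported sum on `Fin 2` with every index supported): `Σ_i 1 ≤ 2·1`. -/
example : ∑ i : Fin 2, (if ((fun _ : Fin 2 => (1 : ℝ)) i) = 0 then (0 : ℝ) else 1) ≤ (2 : ℕ) * (1 : ℝ) :=
  ite_support_sum_le (ι := Fin 2) (fun _ => (1 : ℝ)) (fun _ => 1) (fun _ => le_rfl) zero_le_one (by simp)

end Summit.QuantumFields.BalabanUV.T4Continuum.NE7b.SupFourthKernelSlotSums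

end
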